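import Summits.BirchSwinnertonDyer.BirchSwinnertonDyer.Theorems.Rank1ResidualJetDefs
import HarnessLib

/-!
# T1 JET road K WITHOUT the `p`-adic tower — part 16: the mod-`p` carrier statements IMPLY the reading binders
# `JET.JetchevDivisibilityCarrier{Ne,Mult,Add}` (width seat `bsd-wall-soed-p2-w2` g5; `--supports`, helper)

Series note (see `Rank1ResidualJetModPCebotarev`, part 1, and `Rank1ResidualJetModPCarrierEndFormsFinal`, part 15). The three
reading binders of cell `bsd-jet` (`@[conjecture] def`, `Rank1ResidualJetDefs`) carry the `p`-adic tower; the displayed mod-`p`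
statements of the series carry `ρ̄_p` onto only. Since the tower gives `ρ̄_p` onto at `n = 1`, each mod-`p` statement implies
the corresponding reading binder — three one-line bookkeeping theorems, so that any consumer keyed to K1 ∕ K3 ∕ K4 can be fed by
the mod-`p` end forms (`…_of_swapLiterature_modP`). Nothing is asserted; no definition, no `sorry`; BSD is not proved by this file.
References: [cite: Jetchev2008, Thm. 1.4 (p. 812)] [cite: Elkies2006, Introduction].
-/

set_option autoImplicit false

noncomputable section

open scoped Classical

open WeierstrassCurve Literature.NumberTheory.EllipticCurves Literature.NumberTheory.EllipticCurves.ModularForms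

namespace Summit.BirchSwinnertonDyer.Rank1Residual.JET

/-- **K1 (`JetchevDivisibilityCarrierNe`, tower) ⟸ its mod-`p` form** (the tower gives `ρ̄_p` onto at `n = 1`). Bookkeeping.
[cite: Jetchev2008, Thm. 1.4 (p. 812)] -/
theorem jetchevDivisibilityCarrierNe_of_modP
    (h : ∀ (W : WeierstrassCurve ℚ) [W.IsElliptic] [W.IsGloballyMinimal] [NeZero (W.conductorNorm ℤ)],
        ¬ W.HasCM →
        ∀ (K : Type) [Field K] [NumberField K], IsImaginaryQuadratic K →
        NumberField.discr K ≠ -3 → NumberField.discr K ≠ -4 →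
        SatisfiesHeegnerHypothesis (W.conductorNorm ℤ) K →
        ∀ (p : ℕ) [Fact p.Prime], p ≠ 2 → W.HasSurjectiveModNGaloisRep p →
        ∀ (Dt : ModularParametrizationData W (W.conductorNorm ℤ)) (β : ℤ) (ι : K →+* ℂ)
          (d₁ : KolyvaginHeegnerData Dt β ι 1), ¬ IsOfFinAddOrder d₁.derivedPoint →
        ∀ (q : ℕ) [Fact q.Prime], q ∣ W.conductorNorm ℤ → q ≠ p →
        ∀ (s : ℕ), s ≤ padicValNat p ((W.baseChange ℚ_[q]).localTamagawaNumber ℤ_[q]) →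
        ∀ (n : ℕ) (d : KolyvaginHeegnerData Dt β ι n), Squarefree n →
          (∀ ℓ ∈ n.primeFactors, Zhang2014.IsKolyvaginPrime (W.conductorNorm ℤ) W K p ℓ ∧
            s ≤ Zhang2014.kolyvaginIndex W p ℓ) →
          ∃ Q : (W.baseChange (ringClassField K ι n)).toAffine.Point,
            ((p ^ s : ℕ) : ℤ) • Q = d.derivedPoint) :
    JetchevDivisibilityCarrierNe := by
  intro W _ _ _ hcm K _ _ hK hD3 hD4 hH p _ hp2 htower Dt β ι d₁ hy q _ hq hqp s hs n d hn hℓ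
  exact h W hcm K hK hD3 hD4 hH p hp2 (by simpa using htower 1) Dt β ι d₁ hy q hq hqp s hs n d hn hℓ

/-- **K3 (`JetchevDivisibilityCarrierMult`, tower) ⟸ its mod-`p` form.** Bookkeeping. [cite: Jetchev2008, Thm. 1.4 (p. 812)] -/
theorem jetchevDivisibilityCarrierMult_of_modP
    (h : ∀ (W : WeierstrassCurve ℚ) [W.IsElliptic] [W.IsGloballyMinimal] [NeZero (W.conductorNorm ℤ)],
        ¬ W.HasCM →
        ∀ (K : Type) [Field K] [NumberField K], IsImaginaryQuadratic K →
        NumberField.discr K ≠ -3 → NumberField.discr K ≠ -4 →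
        SatisfiesHeegnerHypothesis (W.conductorNorm ℤ) K →
        ∀ (p : ℕ) [Fact p.Prime], p ≠ 2 → W.HasMultiplicativeReductionAtPrime p →
          W.HasSurjectiveModNGaloisRep p →
        ∀ (Dt : ModularParametrizationData W (W.conductorNorm ℤ)) (β : ℤ) (ι : K →+* ℂ)
          (d₁ : KolyvaginHeegnerData Dt β ι 1), ¬ IsOfFinAddOrder d₁.derivedPoint →
        ∀ (s : ℕ), s ≤ padicValNat p ((W.baseChange ℚ_[p]).localTamagawaNumber ℤ_[p]) →
        ∀ (n : ℕ) (d : KolyvaginHeegnerData Dt β ι n), Squarefree n →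
          (∀ ℓ ∈ n.primeFactors, Zhang2014.IsKolyvaginPrime (W.conductorNorm ℤ) W K p ℓ ∧
            s ≤ Zhang2014.kolyvaginIndex W p ℓ) →
          ∃ Q : (W.baseChange (ringClassField K ι n)).toAffine.Point,
            ((p ^ s : ℕ) : ℤ) • Q = d.derivedPoint) :
    JetchevDivisibilityCarrierMult := by
  intro W _ _ _ hcm K _ _ hK hD3 hD4 hH p _ hp2 hmult htower Dt β ι d₁ hy s hs n d hn hℓ
  exact h W hcm K hK hD3 hD4 hH p hp2 hmult (by simpa using htower 1) Dt β ι d₁ hy s hs n d hn hℓ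

/-- **K4 (`JetchevDivisibilityCarrierAdd`, tower) ⟸ its mod-`p` form.** Bookkeeping. [cite: Jetchev2008, Thm. 1.4 (p. 812)] -/
theorem jetchevDivisibilityCarrierAdd_of_modP
    (h : ∀ (W : WeierstrassCurve ℚ) [W.IsElliptic] [W.IsGloballyMinimal] [NeZero (W.conductorNorm ℤ)],
        ¬ W.HasCM →
        ∀ (K : Type) [Field K] [NumberField K], IsImaginaryQuadratic K →
        NumberField.discr K ≠ -3 → NumberField.discr K ≠ -4 →
        SatisfiesHeegnerHypothesis (W.conductorNorm ℤ) K →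
        ∀ (p : ℕ) [Fact p.Prime], p ≠ 2 →
          ¬ W.HasGoodReductionAtPrime p → ¬ W.HasMultiplicativeReductionAtPrime p →
          W.HasSurjectiveModNGaloisRep p →
        ∀ (Dt : ModularParametrizationData W (W.conductorNorm ℤ)) (β : ℤ) (ι : K →+* ℂ)
          (d₁ : KolyvaginHeegnerData Dt β ι 1), ¬ IsOfFinAddOrder d₁.derivedPoint →
        ∀ (s : ℕ), s ≤ padicValNat p ((W.baseChange ℚ_[p]).localTamagawaNumber ℤ_[p]) →
        ∀ (n : ℕ) (d : KolyvaginHeegnerData Dt β ι n), Squarefree n →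
          (∀ ℓ ∈ n.primeFactors, Zhang2014.IsKolyvaginPrime (W.conductorNorm ℤ) W K p ℓ ∧
            s ≤ Zhang2014.kolyvaginIndex W p ℓ) →
          ∃ Q : (W.baseChange (ringClassField K ι n)).toAffine.Point,
            ((p ^ s : ℕ) : ℤ) • Q = d.derivedPoint) :
    JetchevDivisibilityCarrierAdd := by
  intro W _ _ _ hcm K _ _ hK hD3 hD4 hH p _ hp2 hgood hmult htower Dt β ι d₁ hy s hs n d hn hℓ
  exact h W hcm K hK hD3 hD4 hH p hp2 hgood hmult (by simpa using htower 1) Dt β ι d₁ hy s hs n d hn hℓ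

end Summit.BirchSwinnertonDyer.Rank1Residual.JET

end
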